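import Summits.Ventures.AbcSig.Rows.TemplateAB
import Summits.Ventures.AbcSig.Levels.N478
import Summits.Ventures.AbcSig.Levels.N7648

/-!
# Venture AbcSig — ROW `C2aL239A3AB`: `239^m·xⁿ + 2^a·yⁿ = z²` (SECOND coefficient distribution of the cell; the distribution `xⁿ + 2^a·239^m·yⁿ = z²` is `Rows/C2aL239A3.lean`), class `a 3` (GENERATED by plean/leanrow.py)

HONEST FRAMING. A row of a COMPUTATION cell (`pub-abcsig`); a CONDITIONAL theorem, no claim on ABC or any summit.
Hypotheses: `BS04Package` (CITED), `DataComplete` at levels [478, 7648] (COMPUTED, two-engine certified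
level files), and the listed per-orbit exclusions `hX_…` (CITED; the
row's R5 cell names each). Everything else is kernel-checked (`Rows/TemplateAB.lean`, `Levels/N….lean` — the SAME level files as the first distribution). Exponent
range: prime `n ≥ 11`, `n ≠ 239`; `B = 2^a 239^m` with `a, m < n` (n-th-power free).
Row of record: `census/rows/C2a/C2a-l239-a3.md` (sha256 `40ff31dff1f69708…`; SIGNED 2026-08-22T13:53:57Z by referee (ref-g10)); its R0: THEOREM (sieve-complete) for all primes n >= 11 with n coprime to 1912 — class: candidate (a ∈ {0,3} cell, BATCH-03; lit/COVERAGE §C2 + I–K 2006 Thm 1.1 (n ∈ {0. Exponents left open by the row of record are excluded here via `hres`; kernel-sieve residuals the row of record closes by a cell module (M6 Eisenstein / M4 Kraus certificates) appear as CITED hypotheses `hX_…`.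
-/

namespace Summit.Ventures.AbcSig

/-- Row `C2aL239A3AB`: second coefficient distribution `239^m·xⁿ + 2^a·yⁿ = z²` (see module docstring). -/
theorem row_C2aL239A3AB (M : NewformModel) (hP : M.BS04Package)
    (hD478 : M.DataComplete 478 level478Orbits) (hD7648 : M.DataComplete 7648 level7648Orbits)
    (n : ℕ) (hn : n.Prime) (hmin : 11 ≤ n) (hnℓ : n ≠ 239) (m : ℕ) (hm : 1 ≤ m) (hmn : m < n)
    
    (x y z : ℤ) (hxy1 : x * y ≠ 1) (hxy2 : x * y ≠ -1) : ¬ IsPrimitiveSolution (239 ^ m) (2 ^ 3) 1 n x y z := by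
  have hℓ : Nat.Prime 239 := by norm_num
  have h7 : 7 ≤ n := by omega
  have hS478 :=
    (level478_sieve n hn h7 (fun o => M.Excludes 478 o (famAB (239 ^ m) (2 ^ 3) n (fun _ _ => True))) (fun h => absurd h (by simp only [List.mem_cons, List.not_mem_nil, or_false]; omega)))
  have hS7648 :=
    (level7648_sieve n hn h7 (fun o => M.Excludes 7648 o (famAB (239 ^ m) (2 ^ 3) n (fun _ _ => True))) (fun h => absurd h (by simp only [List.mem_cons, List.not_mem_nil, or_false]; omega)) (fun h => absurd h (by simp only [List.mem_cons, List.not_mem_nil, or_false]; omega)) (fun h => absurd h (by simp only [List.mem_cons, List.not_mem_nil, or_false]; omega)) (fun h => absurd h (by simp only [List.mem_cons, List.not_mem_nil, or_false]; omega)) (fun h => absurd h (by simp only [List.mem_cons, List.not_mem_nil, or_false]; omega)) (fun h => absurd h (by simp only [List.mem_cons, List.not_mem_nil, or_false]; omega)) (fun h => absurd h (by simp only [List.mem_cons, List.not_mem_nil, or_false]; omega)) (fun h => absurd h (by simp only [List.mem_cons, List.not_mem_nil, or_false]; omega)))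
  exact rowC2aAB_a3 239 hℓ (by norm_num) M hP n hn h7 hnℓ hD7648 hD478 m hm hmn
    hS7648
    hS478 x y z hxy1 hxy2

end Summit.Ventures.AbcSig
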